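import Literature.IUT.HodgeTheaters.InitialThetaDataRemarksProofs
import HarnessLib

/-!
# D-0123(C) IUT REPAIR-CATALOGUE (rung LADDER-ABC:A2), proposed row RC-441 (lit-1 g3 L1-102): Zhou's «2-torsion
# initial Θ-data» — the datum class TYPED, and its one printed consequence for [IUTchI] Rmk 3.1.5 («`K` is Galois
# over `F_mod` still holds») PROVED with no torsion input

Record file (D-0012) of the abc-iut cell; SUPPORT / pre-work typed by the floating NEW-row tester abc-iut-rcat-tst-8
(gen 4) for the catalogue row RC-441 proposed in `HOME/staging/RCAT/lit-1/FOLD-PACKET-lit1-g3.tsv` (cataloguer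
abc-iut-rcat-cat-1; the KERNEL-CLOSE word stays with the parity holder rcat-tst-1 or rcat-tst-2, minted only on a KEY;
this file changes no count by itself; decl census `HOME/staging/RCAT/tst-8/PREWORK-RC-441.md`). TAKES NO SIDE on
[IUTchIII] Cor. 3.12 / [IUTchIV] Thm. 1.10, on Z.-P. Zhou's claims or on any author (D-0045); nothing here asserts abc
proved or refuted; typed ≠ proved; located ≠ adjudicated.

Source (held, `lit read arxiv:2510.05448`, chunk p0007 l.5–30): Zhong-Peng Zhou, *The inter-universal Teichmüller theory
and new Diophantine results over rational numbers. II* (arXiv:2510.05448, 2025; unrefereed; bib `ZhouIUT2025b`, claim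
status disputed), §2.1 **Definition 2.1**: "We shall refer to 2-torsion initial Θ-data as any collection of data
`(F̄/F, X_F, l, C̲_K, V̲, V^bad_mod, ε̲)` satisfying the following conditions: [IUTchI], Definition 3.1, (a), (c), (d),
(e), (f). • The “2-torsion version” of [IUTchI], Definition 3.1, (b), i.e., the condition obtained by replacing …
“2·3-torsion points of `E_F` are rational over `F`”, by “2-torsion points of `E_F` are rational over `F`, and `E_F` has
a model over `F_mod`”." and l.19–24: "… the condition “`F(E[3]) = F`” is only used in [IUTchI], Remark 3.1.5, [IUTchIV],
Theorem 1.10 and [IUTchIV], Corollary 2.2 via [IUTchIV], Proposition 1.8, (iv), (v). As a consequence of “`F(E[3]) =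
F`”, it is stated that `K` is Galois over `F_mod` at the beginning of [IUTchI], Remark 3.1.5. This still holds for its
2-torsion version. Since `E_F` has a model `E` defined over `F_mod`, we can put `L = F_mod(E[l])`, then `L/F_mod` is
Galois. Since `F/F_mod` is Galois … `K = F(E_F[l]) = F·L` is Galois over `F_mod`." (Also IUT Summit 2025 deck sl. 26–27.)

## What is typed and what is proved (standard axioms; no `sorry`; no new named fact)
* §1 `TwoTorsionInitialThetaData F K Fbar E l P` — Definition 2.1 as a hypothesis structure: the FIELDS of the tree's
  `Literature.IUT.HodgeTheaters.InitialThetaData` ([IUTchI] Def. 3.1, abc-iut-L5-t2, DEF-FROZEN) VERBATIM, except that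
  the single field `torsion_six_rational` of (b) is REPLACED by the two printed clauses `torsion_two_rational` and
  `exists_model_fieldOfModuli` ("`E_F` has a model over `F_mod`", phrased as in the tree's
  `Literature.IUT.LogVolume.DHFieldOfModuli.IsBuiltFromFieldOfModuli`: `E = c • E₀.baseChange F`, `E₀` a Weierstrass
  equation over `F_mod = fieldOfModuli E = ℚ(j_E)`, `c` an `F`-rational change of variables). "Of odd residue
  characteristic" is KEPT (part of Def. 3.1 (b); Zhou's exception (ii) restores it). Pattern of the tree's sibling
  variant `Literature.IUT.HodgeTheaters.Mu6InitialThetaData` ([ExpEst] Def. 4.1).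
* §2 bookkeeping between the two datum classes (NOT printed assertions): `ofInitialThetaData` (an initial Θ-datum
  WITH a model over `F_mod` — an INPUT here; print derives it from `E[3]`, [IUTchIV] Prop. 1.8 (iv),(v) — is a
  2-torsion one) and `toInitialThetaData` (re-supplying the `2·3`-torsion), a `rfl` lemma, a round trip.
* §3 **kernel twin of the printed sentence "`K = F·F_mod(E[l])` is Galois over `F_mod`"**: `kGalois_of_exists_model` —
  for ANY Weierstrass curve `E/F` with `F/F_mod` Galois, a model over `F_mod`, and `K ⊆ F̄` the fixed field of the
  pointwise stabiliser of `E[l](F̄)` (the formula of Def. 3.1 (c), `range_K_iff`), every ring automorphism of `F̄`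
  fixing `F_mod` pointwise carries `K` into itself — PROVED with NO torsion-rationality input; whence
  `TwoTorsionInitialThetaData.kGaloisOverFieldOfModuli_holds` and, for the tree's own datum class, [IUTchI] Rmk 3.1.5
  (`InitialThetaData.KGaloisOverFieldOfModuli`) re-derived from a model instead of from `E[3]`
  (`kGaloisOverFieldOfModuli_of_exists_model`; the tree's `kGaloisOverFieldOfModuli_holds` uses the nine rational
  `3`-torsion points). The argument is abc-iut-L5-t2's (`InitialThetaDataRemarksProofs`, the [IUTchIV] Prop. 1.8 (iv)
  twist argument) with its rigidity step short-circuited: when `E = c • E₀ ⊗ F` the change of variables carrying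
  `E_{F̄}` to its `σ`-conjugate can be taken to be `c^σ · c⁻¹`, which has coefficients in `F`, so every
  `ρ ∈ Gal(F̄/F)` fixes it.

NOT touched here (census PREWORK-RC-441.md §A/§B): the typed Cor. 3.12 (`Summit.ABC.IUTFork.Cor312.Setting.Statement`)
and the KERNEL-CLOSE beds (`settingPrVolSharp`, `settingPrVolSharpM`, `pilotDataOfK ← pilotDataOfF`, the pinned
countermodel) read no torsion field of the datum; the `3`-part of Def. 3.1 (b) is consumed only by the Def-3.1-remark /
Thm-1.10 companions and by one `F`-level split-reduction file (`InitialThetaDataSplitBaseProofs`; Joshi-side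
consumers). Deliberately NOT here: any EXISTENCE statement for 2-torsion initial Θ-data (Zhou §2 / deck slide 29 over
`ℚ(√−1)`), the «type `(l, N, N′)`» numerology and Cor. 2.2 of the paper, any judgement.
-/

noncomputable section

open scoped Classical

namespace Summit.ABC.IUTFork.Repair.RcatZhouTwoTorsion

open Literature.IUT.HodgeTheaters Literature.NumberTheory.EllipticCurves WeierstrassCurve
open NumberField IsDedekindDomain

universe u v w

/-! ## §1 Definition 2.1: 2-torsion initial Θ-data -/

section Def21
variable (F : Type u) (K : Type v) (Fbar : Type w) [Field F] [NumberField F] [Field K]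
  [NumberField K] [Algebra F K] [Field Fbar] [Algebra F Fbar] [Algebra K Fbar]
  (E : WeierstrassCurve F) [E.IsElliptic] (l : ℕ) (P : BadPlacePredicates K)

/-- "the `n`-torsion points of `E_F` are rational over `F`" in abc-iut-L5-t2's range-of-base-change phrasing (the TYPE
of the field `InitialThetaData.torsion_six_rational` at `n = 6`): every `F̄`-point killed by `n` comes from an
`F`-point. A reading predicate (parameters `Fbar`, `E`, `n`); nothing asserted. [folklore] -/
def TorsionRationalOver (E : WeierstrassCurve F) (n : ℤ) : Prop :=
  ∀ T : GeomPoints Fbar E, n • T = 0 → T ∈ Set.range (WeierstrassCurve.Affine.Point.baseChange (W' := E.toAffine) F Fbar)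

variable {F} in
/-- "`E_F` has a model over `F_mod`" (Zhou Def. 2.1, second clause of the 2-torsion version of (b)), phrased as in the
tree's `Literature.IUT.LogVolume.DHFieldOfModuli.IsBuiltFromFieldOfModuli.exists_model`: `E = c • (E₀ ⊗ F)` for a
Weierstrass equation `E₀` over `F_mod = fieldOfModuli E = ℚ(j_E) ⊆ F` and an `F`-rational change of variables `c`.
A reading predicate; nothing asserted. [claim: ZhouIUT2025b, status: disputed] -/
def HasModelOverFieldOfModuli (E : WeierstrassCurve F) [E.IsElliptic] : Prop :=
  ∃ (E₀ : WeierstrassCurve (fieldOfModuli E)) (c : VariableChange F), E = c • E₀.baseChange F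

/-- **Zhou, arXiv:2510.05448 §2.1 Definition 2.1 — 2-torsion initial Θ-data** `(F̄/F, X_F, l, C̲_K, V̲, V^bad_mod, ε̲)`
relative to the carriers `F ⊆ K ⊆ F̄ = Fbar`, the curve `E = E_F`, the prime `l`, the bad-place predicates `P`:
"[IUTchI], Definition 3.1, (a), (c), (d), (e), (f)" and "the “2-torsion version” of (b) … “2-torsion points of `E_F` are
rational over `F`, and `E_F` has a model over `F_mod`”". FIELDS = those of the tree's `InitialThetaData` ([IUTchI]
Def. 3.1, abc-iut-L5-t2) VERBATIM, except `torsion_six_rational` ↦ `torsion_two_rational` + `exists_model_fieldOfModuli`;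
clause letters as there. A hypothesis structure: nothing is asserted, no datum is constructed; the catalogue row
(RC-441) is a claim-tagged reading, never a Literature fact. [claim: ZhouIUT2025b, status: disputed] -/
structure TwoTorsionInitialThetaData where
  /-- (a) "`F` is a number field such that `√−1 ∈ F`". -/
  sqrt_neg_one_mem : ∃ i : F, i ^ 2 = -1
  /-- (a) "`F̄` is an algebraic closure of `F`". -/
  [isAlgClosure : IsAlgClosure F Fbar]
  /-- (c) "`K ⊆ F̄`": the structure maps `F → K → F̄` and `F → F̄` are compatible. -/
  [isScalarTower : IsScalarTower F K Fbar]
  /-- (b) "`X_F` … admits stable reduction over all `v ∈ V(F)^non`": `E_F` is semistable. -/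
  isSemistable : E.IsSemistable (𝓞 F)
  /-- (b) "`V^bad_mod ⊆ V_mod` is a nonempty set of nonarchimedean valuations of `F_mod`" … -/
  VbadMod : Set (FinitePlace (fieldOfModuli E))
  /-- (b) … nonempty … -/
  VbadMod_nonempty : VbadMod.Nonempty
  /-- (b) … "of odd residue characteristic" (kept: [IUTchI] Def. 3.1 (b); Zhou §2.1 exception (ii)) … -/
  VbadMod_odd : ∀ w ∈ VbadMod, Odd (residueChar w)
  /-- (b) … "such that `X_F` has bad [i.e., multiplicative] reduction at the elements of `V(F)` … over `V^bad_mod`". -/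
  multiplicative_over_VbadMod : ∀ v : FinitePlace F,
    Val.restrict (fieldOfModuli E) (Val.non v) ∈ Val.non '' VbadMod →
      E.HasMultiplicativeReductionAt v.maximalIdeal
  /-- (b) "the field extension `F/F_mod` is Galois …" -/
  isGalois_fieldOfModuli : IsGalois (fieldOfModuli E) F
  /-- (b) "… of degree prime to `l`" -/
  finrank_coprime : (Module.finrank (fieldOfModuli E) F).Coprime l
  /-- (b), 2-torsion version, first clause: "2-torsion points of `E_F` are rational over `F`". -/
  torsion_two_rational : TorsionRationalOver F Fbar E 2
  /-- (b), 2-torsion version, second clause: "`E_F` has a model over `F_mod`" (`HasModelOverFieldOfModuli`). -/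
  exists_model_fieldOfModuli : HasModelOverFieldOfModuli E
  /-- (c) "`l` is a prime number …" -/
  l_prime : l.Prime
  /-- (c) "… `≥ 5`" -/
  five_le_l : 5 ≤ l
  /-- (c) "the image of the outer homomorphism `G_F → GL₂(𝔽_l)` … contains `SL₂(𝔽_l)`". -/
  imageContainsSL2 : ImageContainsSL2 Fbar E l
  /-- (c) "`K ⊆ F̄` … the finite Galois extension of `F` determined by the kernel of this homomorphism". -/
  range_K_iff : ∀ x : Fbar, x ∈ Set.range (algebraMap K Fbar) ↔
    ∀ σ : Fbar ≃ₐ[F] Fbar, FixesTorsion E l σ → σ x = x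
  /-- (c) "`l` is prime to the [residue characteristics of the] elements of `V^bad_mod` …" -/
  l_ne_residueChar : ∀ w ∈ VbadMod, residueChar w ≠ l
  /-- (c) "… as well as to the orders of the `q`-parameters of `E_F` at the primes of `V(F)^bad`". -/
  l_coprime_qParamOrd : ∀ v : FinitePlace F,
    Val.restrict (fieldOfModuli E) (Val.non v) ∈ Val.non '' VbadMod →
      l.Coprime (qParamOrd E v.maximalIdeal)
  /-- (d), (f) and the `π₁`-clauses of (b): the INTERFACE `ThetaGeometry` over `G_F ⊇ G_K` (unchanged). -/
  geom : ThetaGeometry.{w} (Fbar ≃ₐ[F] Fbar) (galoisSubgroupOf F K Fbar) l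
  /-- (e) "`V̲ ⊆ V(K)` is a subset …" -/
  V : Set (Val K)
  /-- (e) "… that induces a natural bijection `V̲ ⥲ V_mod`". -/
  V_bijOn : Set.BijOn (toVMod F K E) V Set.univ
  /-- (e) "If `v̲ ∈ V̲^bad`, then … `C̲_v̲` is of type `(1, ℤ/lℤ)^±`" (interface predicate, unchanged). -/
  bad_type : ∀ w ∈ V, toVMod F K E w ∈ Val.non '' VbadMod → P.IsTypeOneZModLPM w
  /-- (f) "If `v̲ ∈ V̲^bad`, then … `ε̲_v̲` is the cusp that arises from the canonical generator [up to sign] '`±1`'"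
  (interface predicate, unchanged). -/
  bad_cusp : ∀ w ∈ V, toVMod F K E w ∈ Val.non '' VbadMod → P.IsCanonicalGeneratorCusp w

end Def21

/-! ## §2 Bookkeeping between [IUTchI] Def. 3.1 and Definition 2.1 (not printed assertions) -/

section Relations
variable {F : Type u} {K : Type v} {Fbar : Type w} [Field F] [NumberField F] [Field K]
  [NumberField K] [Algebra F K] [Field Fbar] [Algebra F Fbar] [Algebra K Fbar]
  {E : WeierstrassCurve F} [E.IsElliptic] {l : ℕ} {P : BadPlacePredicates K}

namespace TwoTorsionInitialThetaData

/-- An initial Θ-datum in the sense of [IUTchI] Def. 3.1 TOGETHER WITH a model of `E_F` over `F_mod` is a 2-torsion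
initial Θ-datum with the same `V^bad_mod`, `V̲` and geometry: points killed by `2` are killed by `6`, so Def. 3.1
(b)'s `2·3`-torsion clause supplies the `2`-torsion clause. The model is an INPUT `hmod` (print obtains it from the
rational `3`-torsion via [IUTchIV] Prop. 1.8 (iv), (v); not re-derived here). NOT a printed assertion.
[claim: ZhouIUT2025b, status: disputed] -/
def ofInitialThetaData (D : InitialThetaData F K Fbar E l P) (hmod : HasModelOverFieldOfModuli E) :
    TwoTorsionInitialThetaData F K Fbar E l P :=
  letI := D.isAlgClosure; letI := D.isScalarTower
  { sqrt_neg_one_mem := D.sqrt_neg_one_mem, isSemistable := D.isSemistable, VbadMod := D.VbadMod,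
    VbadMod_nonempty := D.VbadMod_nonempty, VbadMod_odd := D.VbadMod_odd,
    multiplicative_over_VbadMod := D.multiplicative_over_VbadMod, isGalois_fieldOfModuli := D.isGalois_fieldOfModuli,
    finrank_coprime := D.finrank_coprime,
    torsion_two_rational := fun T h2 => D.torsion_six_rational T (by
      rw [show (6 : ℤ) = 3 * 2 by norm_num, mul_smul, h2, smul_zero]),
    exists_model_fieldOfModuli := hmod, l_prime := D.l_prime, five_le_l := D.five_le_l,
    imageContainsSL2 := D.imageContainsSL2, range_K_iff := D.range_K_iff, l_ne_residueChar := D.l_ne_residueChar,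
    l_coprime_qParamOrd := D.l_coprime_qParamOrd, geom := D.geom, V := D.V, V_bijOn := D.V_bijOn,
    bad_type := D.bad_type, bad_cusp := D.bad_cusp }

/-- `ofInitialThetaData` does not change `V^bad_mod`. [claim: ZhouIUT2025b, status: disputed] -/
@[simp] theorem ofInitialThetaData_VbadMod (D : InitialThetaData F K Fbar E l P) (hmod : HasModelOverFieldOfModuli E) :
    (ofInitialThetaData D hmod).VbadMod = D.VbadMod := rfl

/-- Converse bookkeeping: a 2-torsion initial Θ-datum whose `2·3`-torsion is rational over `F` (the clause of
[IUTchI] Def. 3.1 (b), re-supplied as the hypothesis `h6`) is an initial Θ-datum as typed by `InitialThetaData`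
(the model over `F_mod` is forgotten). NOT a printed assertion. [claim: ZhouIUT2025b, status: disputed] -/
def toInitialThetaData (D : TwoTorsionInitialThetaData F K Fbar E l P) (h6 : TorsionRationalOver F Fbar E 6) :
    InitialThetaData F K Fbar E l P :=
  letI := D.isAlgClosure; letI := D.isScalarTower
  { sqrt_neg_one_mem := D.sqrt_neg_one_mem, isSemistable := D.isSemistable, VbadMod := D.VbadMod,
    VbadMod_nonempty := D.VbadMod_nonempty, VbadMod_odd := D.VbadMod_odd,
    multiplicative_over_VbadMod := D.multiplicative_over_VbadMod, isGalois_fieldOfModuli := D.isGalois_fieldOfModuli,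
    finrank_coprime := D.finrank_coprime, torsion_six_rational := h6, l_prime := D.l_prime, five_le_l := D.five_le_l,
    imageContainsSL2 := D.imageContainsSL2, range_K_iff := D.range_K_iff, l_ne_residueChar := D.l_ne_residueChar,
    l_coprime_qParamOrd := D.l_coprime_qParamOrd, geom := D.geom, V := D.V, V_bijOn := D.V_bijOn,
    bad_type := D.bad_type, bad_cusp := D.bad_cusp }

/-- Round trip: re-supplying the `2·3`-torsion and forgetting it again returns the datum. [claim: ZhouIUT2025b, status: disputed] -/
theorem ofInitialThetaData_toInitialThetaData (D : TwoTorsionInitialThetaData F K Fbar E l P)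
    (h6 : TorsionRationalOver F Fbar E 6) : ofInitialThetaData (D.toInitialThetaData h6) D.exists_model_fieldOfModuli = D := by
  cases D; rfl

end TwoTorsionInitialThetaData

end Relations

/-! ## §3 "`K` is Galois over `F_mod` … still holds for its 2-torsion version" — PROVED, torsion-free -/

section KGalois

variable {F : Type u} {K : Type v} {Fbar : Type w} [Field F] [NumberField F] [Field K]
  [NumberField K] [Algebra F K] [Field Fbar] [Algebra F Fbar] [Algebra K Fbar]
  {E : WeierstrassCurve F} [E.IsElliptic] {l : ℕ}

/-- "`F` is Galois over `F_mod`" ⟹ a ring automorphism of `F̄` fixing `F_mod` pointwise carries `F ⊆ F̄` into itself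
(normality; Mathlib's `AlgHom.restrictNormal`) — the tree's `InitialThetaData.map_F_mem_range_of_fixes_fieldOfModuli`
with its one used field made a bare hypothesis. [folklore] -/
theorem map_F_mem_range_of_fixes_fieldOfModuli (hGal : IsGalois (fieldOfModuli E) F) (σ : Fbar ≃+* Fbar)
    (hσ : ∀ x : fieldOfModuli E, σ (algebraMap F Fbar (x : F)) = algebraMap F Fbar (x : F))
    (a : F) : σ (algebraMap F Fbar a) ∈ Set.range (algebraMap F Fbar) := by
  haveI := hGal
  have hσ' : ∀ x : fieldOfModuli E, σ (algebraMap (fieldOfModuli E) Fbar x) =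
      algebraMap (fieldOfModuli E) Fbar x := fun x => by
    rw [IsScalarTower.algebraMap_apply (fieldOfModuli E) F Fbar]
    exact hσ x
  let σ' : Fbar →ₐ[fieldOfModuli E] Fbar := AlgHom.mk (σ : Fbar →+* Fbar) hσ'
  exact ⟨σ'.restrictNormal F a, AlgHom.restrictNormal_commutes σ' F a⟩

/-- **The heart, torsion-free.** Let `E/F` have a model over `F_mod` (`E = c • E₀ ⊗ F`) and `F/F_mod` be Galois. If
`σ ∈ Aut(F̄)` fixes `F_mod` pointwise and `ρ ∈ Gal(F̄/F)` fixes `E_F[l](F̄)` pointwise, then `ρ` fixes the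
`σ`-conjugates of the coordinates of every `l`-torsion point. Versus the tree's
`InitialThetaData.apply_conj_torsion_eq_of_fixesTorsion` ([IUTchIV] Prop. 1.8 (iv): the cocycle `C⁻¹ρ(C)` is killed by
rigidity on the nine `F`-rational `3`-torsion points), the change of variables with `C • E_{F̄} = E^σ` is here
`c^σ · c⁻¹`, visibly `F`-rational, so `ρ(C) = C` is immediate and no torsion rationality enters — the kernel content
of Zhou's "Since `E_F` has a model `E` defined over `F_mod` … `K = F·L` is Galois over `F_mod`".
[claim: ZhouIUT2025b, status: disputed] -/
theorem apply_conj_torsion_eq_of_fixesTorsion_of_exists_model (hGal : IsGalois (fieldOfModuli E) F)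
    (hmod : HasModelOverFieldOfModuli E) (σ : Fbar ≃+* Fbar)
    (hσ : ∀ x : fieldOfModuli E, σ (algebraMap F Fbar (x : F)) = algebraMap F Fbar (x : F))
    (ρ : Fbar ≃ₐ[F] Fbar) (hρ : FixesTorsion E l ρ) {x y : Fbar}
    (h : (E.baseChange Fbar).toAffine.Nonsingular x y)
    (hT : (l : ℤ) • (Affine.Point.some x y h : (E.baseChange Fbar).toAffine.Point) = 0) :
    ρ (σ x) = σ x ∧ ρ (σ y) = σ y := by
  -- the ring homomorphisms underlying `ρ`, `σ` and the structure map `ι : F → F̄`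
  obtain ⟨ρr, hρr⟩ : ∃ ρr : Fbar →+* Fbar, ∀ z, ρr z = ρ z := ⟨(ρ : Fbar →ₐ[F] Fbar), fun _ => rfl⟩
  set σr : Fbar →+* Fbar := (σ : Fbar →+* Fbar) with hσr_def
  have hσr : ∀ z, σr z = σ z := fun _ => rfl
  set ι : F →+* Fbar := algebraMap F Fbar with hι
  -- (1) `F/F_mod` normal: `σ(F) = F`, so `ρ` fixes `F` and `σ(F)` pointwise
  have hF : ∀ a : F, ∃ a' : F, ι a' = σ (ι a) := fun a => map_F_mem_range_of_fixes_fieldOfModuli hGal σ hσ a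
  have hρι : ∀ a : F, ρr (ι a) = ι a := fun a => by rw [hρr]; exact ρ.commutes a
  have hρσι : ∀ a : F, ρr (σr (ι a)) = σr (ι a) := fun a => by
    obtain ⟨a', ha'⟩ := hF a
    rw [hσr, ← ha', hρι]
  have hρι' : ρr.comp ι = ι := RingHom.ext hρι
  have hρσι' : ρr.comp (σr.comp ι) = σr.comp ι := RingHom.ext fun a => hρσι a
  -- (2) the model: `W₁ = E_{F̄} = c_{F̄} • W₀`, `W₂ = E^σ = c^σ_{F̄} • W₀`, `W₀ = E₀ ⊗ F̄` fixed by `σ`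
  obtain ⟨E₀, c, hE⟩ := hmod
  let W₁ : WeierstrassCurve Fbar := E.baseChange Fbar
  have hW₁ : W₁ = E.map ι := rfl
  let W₂ : WeierstrassCurve Fbar := W₁.map σr
  have hW₂ : W₂ = W₁.map σr := rfl
  let W₀ : WeierstrassCurve Fbar := (E₀.baseChange F).map ι
  have hW₀σ : W₀.map σr = W₀ := by
    show ((E₀.baseChange F).map ι).map σr = (E₀.baseChange F).map ι
    simp only [WeierstrassCurve.baseChange, WeierstrassCurve.map_map]
    congr 1; ext z; simp only [RingHom.coe_comp, Function.comp_apply]; exact hσ z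
  have hW₁' : W₁ = (c.map ι) • W₀ := by rw [hW₁, hE, ← WeierstrassCurve.map_variableChange]
  have hW₂' : W₂ = (c.map (σr.comp ι)) • W₀ := by
    rw [hW₂, hW₁', ← WeierstrassCurve.map_variableChange, hW₀σ, VariableChange.map_map]
  -- the `F`-rational change of variables `C = c^σ · c⁻¹` with `C • W₁ = W₂`
  set C : VariableChange Fbar := c.map (σr.comp ι) * (c.map ι)⁻¹ with hC_def
  have hC : C • W₁ = W₂ := by rw [hW₁', hC_def, mul_smul, inv_smul_smul, ← hW₂']
  -- (3) `ρ` fixes `C`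
  have hCρ : C.map ρr = C := by
    have e1 : (c.map (σr.comp ι)).map ρr = c.map (σr.comp ι) := by rw [VariableChange.map_map, hρσι']
    have e2 : (c.map ι).map ρr = c.map ι := by rw [VariableChange.map_map, hρι']
    have : C.map ρr = VariableChange.mapHom ρr C := rfl
    rw [this, hC_def, map_mul, map_inv]
    show (c.map (σr.comp ι)).map ρr * ((c.map ι).map ρr)⁻¹ = _
    rw [e1, e2]
  -- hence `ρ` fixes the coordinates of `e(T)` for every `ρ`-fixed affine point `T` of `W₁`
  have keyl : ∀ {a b : Fbar} (hab : W₁.toAffine.Nonsingular a b),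
      (l : ℤ) • (Affine.Point.some a b hab : W₁.toAffine.Point) = 0 →
        ρr (C.toX a) = C.toX a ∧ ρr (C.toY a b) = C.toY a b := by
    intro a b hab hlT
    have hfix := hρ (Affine.Point.some a b hab) hlT
    rw [galoisAct, Affine.Point.map_some, Affine.Point.some.injEq] at hfix
    have ha : ρr a = a := by rw [hρr]; exact hfix.1
    have hb : ρr b = b := by rw [hρr]; exact hfix.2
    exact ⟨by rw [map_toX_ringHom, hCρ, ha], by rw [map_toY_ringHom, hCρ, ha, hb]⟩
  -- (4) `σ̃ : E(F̄) → E^σ(F̄)` and `e : E(F̄) ≃ E^σ(F̄)`; `σ̃ T ∈ E^σ[l] = e(E[l])`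
  obtain ⟨f, hf⟩ := exists_pointHom_map W₁ σr
  let e : W₁.toAffine.Point ≃+ W₂.toAffine.Point :=
    (VariableChange.pointEquiv W₁ C).trans (Affine.Point.congrEquiv hC)
  have he : ∀ {a b : Fbar} (hab : W₁.toAffine.Nonsingular a b),
      e (Affine.Point.some a b hab) = Affine.Point.some (C.toX a) (C.toY a b)
        (hC ▸ (VariableChange.nonsingular_iff W₁ C a b).mpr hab) := fun hab => by
    simp only [e, AddEquiv.trans_apply, VariableChange.pointEquiv_some, Affine.Point.congrEquiv_some]
  have hQ := hf h; have hlQ : (l : ℤ) • f (Affine.Point.some x y h) = 0 := by rw [← map_zsmul, hT, map_zero]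
  have hlP : (l : ℤ) • e.symm (f (Affine.Point.some x y h)) = 0 := by rw [← map_zsmul, hlQ, map_zero]
  rcases hP : e.symm (f (Affine.Point.some x y h)) with _ | ⟨x', y', h'⟩
  · have h0 : f (Affine.Point.some x y h) = 0 := by
      rw [← e.apply_symm_apply (f _), hP, ← Affine.Point.zero_def, map_zero]
    exact absurd (hQ ▸ h0) (Affine.Point.some_ne_zero _)
  · rw [hP] at hlP
    obtain ⟨hX, hY⟩ := keyl h' hlP
    have heP : e (Affine.Point.some x' y' h') = f (Affine.Point.some x y h) := by rw [← hP, e.apply_symm_apply]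
    rw [he, hQ, Affine.Point.some.injEq] at heP
    rw [← hρr, ← hρr, ← hσr x, ← hσr y, ← heP.1, ← heP.2]
    exact ⟨hX, hY⟩

omit [NumberField K] in
/-- **"`K` is Galois over `F_mod`" from a model over `F_mod` — no torsion input.** For any Weierstrass curve `E/F` with
`F/F_mod` Galois and a model over `F_mod`, and `K ⊆ F̄` cut out by the `l`-torsion as in [IUTchI] Def. 3.1 (c) (`hK` = the
formula of the field `range_K_iff`), every ring automorphism of `F̄` fixing `F_mod` pointwise carries `K` into itself
(the formula of the tree's `InitialThetaData.KGaloisOverFieldOfModuli`). Zhou §2.1 "`K = F(E_F[l]) = F·L` is Galois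
over `F_mod`", in the tree's fixed-field form: `σ⁻¹ρσ` fixes `E_F[l]` pointwise for every `ρ ∈ Gal(F̄/K)` (the heart),
and `K` is the fixed field of the pointwise stabiliser. PROVED. [claim: ZhouIUT2025b, status: disputed] -/
theorem kGalois_of_exists_model [IsScalarTower F K Fbar] (hGal : IsGalois (fieldOfModuli E) F)
    (hmod : HasModelOverFieldOfModuli E)
    (hK : ∀ x : Fbar, x ∈ Set.range (algebraMap K Fbar) ↔
      ∀ σ : Fbar ≃ₐ[F] Fbar, FixesTorsion E l σ → σ x = x)
    (σ : Fbar ≃+* Fbar)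
    (hσ : ∀ x : fieldOfModuli E, σ (algebraMap F Fbar (x : F)) = algebraMap F Fbar (x : F))
    (y : K) : σ (algebraMap K Fbar y) ∈ Set.range (algebraMap K Fbar) := by
  have hF : ∀ a : F, ∃ a' : F, algebraMap F Fbar a' = σ (algebraMap F Fbar a) := fun a =>
    map_F_mem_range_of_fixes_fieldOfModuli hGal σ hσ a
  rw [hK]
  intro ρ hρ
  -- `ρ' := σ⁻¹ ∘ ρ ∘ σ` is an `F`-algebra automorphism of `F̄` …
  have hcomm : ∀ a : F, ((σ.trans (ρ : Fbar ≃+* Fbar)).trans σ.symm) (algebraMap F Fbar a) =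
      algebraMap F Fbar a := by
    intro a
    obtain ⟨a', ha'⟩ := hF a
    rw [RingEquiv.trans_apply, RingEquiv.trans_apply, RingEquiv.symm_apply_eq, ← ha']
    exact ρ.commutes a'
  let ρ' : Fbar ≃ₐ[F] Fbar := AlgEquiv.ofRingEquiv hcomm
  -- … fixing `E_F[l]` pointwise
  have hρ' : FixesTorsion E l ρ' := by
    intro T hlT
    rcases T with _ | ⟨x, y, h⟩
    · simp only [← Affine.Point.zero_def, map_zero]
    · obtain ⟨hx, hy⟩ :=
        apply_conj_torsion_eq_of_fixesTorsion_of_exists_model hGal hmod σ hσ ρ hρ h hlT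
      rw [galoisAct, Affine.Point.map_some]
      simp only [Affine.Point.some.injEq]
      exact ⟨show σ.symm (ρ (σ x)) = x by rw [hx, RingEquiv.symm_apply_apply],
        show σ.symm (ρ (σ y)) = y by rw [hy, RingEquiv.symm_apply_apply]⟩
  have hfixK := (hK (algebraMap K Fbar y)).mp ⟨y, rfl⟩ ρ' hρ'
  change σ.symm (ρ (σ (algebraMap K Fbar y))) = algebraMap K Fbar y at hfixK
  rw [RingEquiv.symm_apply_eq] at hfixK
  exact hfixK

variable {P : BadPlacePredicates K}

namespace TwoTorsionInitialThetaData

/-- "`K` is Galois over `F_mod`" for a 2-torsion initial Θ-datum — the SAME formula as the tree's typing of [IUTchI]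
Rmk. 3.1.5, `InitialThetaData.KGaloisOverFieldOfModuli` (keyed on an initial Θ-datum, so not applicable to `D`; see
`kGaloisOverFieldOfModuli_iff_toInitialThetaData`): every ring automorphism of `F̄` fixing `F_mod` pointwise carries
`K` into itself. Zhou §2.1 "This still holds for its 2-torsion version"; proved below. [claim: ZhouIUT2025b, status: disputed] -/
def KGaloisOverFieldOfModuli (_D : TwoTorsionInitialThetaData F K Fbar E l P) : Prop :=
  ∀ σ : Fbar ≃+* Fbar,
    (∀ x : fieldOfModuli E, σ (algebraMap F Fbar (x : F)) = algebraMap F Fbar (x : F)) →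
      ∀ y : K, σ (algebraMap K Fbar y) ∈ Set.range (algebraMap K Fbar)

/-- The two typings of "`K` is Galois over `F_mod`" are the same formula (definitional `Iff`): for a 2-torsion datum
that happens to have rational `2·3`-torsion, the tree's `InitialThetaData.KGaloisOverFieldOfModuli` of the associated
initial Θ-datum IS `D.KGaloisOverFieldOfModuli`. [claim: ZhouIUT2025b, status: disputed] -/
theorem kGaloisOverFieldOfModuli_iff_toInitialThetaData (D : TwoTorsionInitialThetaData F K Fbar E l P)
    (h6 : TorsionRationalOver F Fbar E 6) : (D.toInitialThetaData h6).KGaloisOverFieldOfModuli ↔ D.KGaloisOverFieldOfModuli :=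
  Iff.rfl

/-- **Zhou §2.1, "`K` is Galois over `F_mod` … still holds for its 2-torsion version" — DISCHARGED**: for a
2-torsion initial Θ-datum, every ring automorphism of `F̄` fixing `F_mod` pointwise carries `K ⊆ F̄` into itself;
from the fields `isGalois_fieldOfModuli`, `exists_model_fieldOfModuli`, `range_K_iff` ONLY (`kGalois_of_exists_model`).
[claim: ZhouIUT2025b, status: disputed] -/
theorem kGaloisOverFieldOfModuli_holds (D : TwoTorsionInitialThetaData F K Fbar E l P) : D.KGaloisOverFieldOfModuli := by
  haveI := D.isScalarTower
  exact fun σ hσ y => kGalois_of_exists_model D.isGalois_fieldOfModuli D.exists_model_fieldOfModuli D.range_K_iff σ hσ y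

end TwoTorsionInitialThetaData

/-- For the tree's own datum class: [IUTchI] Rmk. 3.1.5 ("`K` is Galois over `F_mod`",
`InitialThetaData.KGaloisOverFieldOfModuli`) follows from a MODEL over `F_mod` without touching the field
`torsion_six_rational` (contrast: the tree's `InitialThetaData.kGaloisOverFieldOfModuli_holds` uses the nine
`F`-rational `3`-torsion points). Kernel form of Zhou's "This still holds for its 2-torsion version".
[claim: ZhouIUT2025b, status: disputed] -/
theorem kGaloisOverFieldOfModuli_of_exists_model (D : InitialThetaData F K Fbar E l P)
    (hmod : HasModelOverFieldOfModuli E) : D.KGaloisOverFieldOfModuli :=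
  (TwoTorsionInitialThetaData.ofInitialThetaData D hmod).kGaloisOverFieldOfModuli_holds

end KGalois

end Summit.ABC.IUTFork.Repair.RcatZhouTwoTorsion
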